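import Mathlib
import Summits.ResolutionOfSingularities.ResolutionOfSingularities.Theorems.HomologicalConductorPersistenceMonogenicJacobian
import HarnessLib

/-!
# Jacobian criterion for `S[X]/(f)` (`f` monic) and for hypersurfaces monic in `z` over `k[x₁, …, x_d]`

Crux `HomologicalConductor.Persistence` (stmt-ResolutionOfSingularities-16484), chain W4.4b. `[OURS · L1 w44b]`
— corollaries of `Theorems/HomologicalConductorPersistenceMonogenicJacobian.lean` (general relation
`f(z) = 0`): `adjoinRoot_free_finite_of_monic`, `adjoinRoot_span_jacobian_le` (`B = S[X]/(f)`, `f`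
monic, `S` noetherian with `caᵈ⁺¹(S) = S`: `(f'(z), f^{δᵢ}(z) : i)·B ⊆ caᵈ⁺¹(B)`),
`mvPolynomial_span_jacobian_le_aeval` (`S = k[x₁, …, x_d]`, `∂f/∂xᵢ` coefficientwise: the classical
Jacobian criterion `(∂f/∂z, ∂f/∂x₁, …, ∂f/∂x_d)·B ⊆ caᵈ⁺¹(B)` for a hypersurface `f = 0` monic in
`z`, every characteristic, exponent one at syzygy level `d + 1`). NOT a statement of the manuscript
under review; AI-drafted (weaker than expert review).
-/

-- single-problem summit: the doubled namespace component is forced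
set_option linter.dupNamespace false

noncomputable section

open CategoryTheory CategoryTheory.Abelian Polynomial
open scoped TensorProduct

universe u

namespace Summit.ResolutionOfSingularities.ResolutionOfSingularities.Theorems.HomologicalConductor.PersistenceMonogenicJacobianCorollaries

open Literature.RingTheory.CohomologyAnnihilator
open Summit.ResolutionOfSingularities.ResolutionOfSingularities.Theorems.HomologicalConductor.PersistenceMonogenicJacobian

/-! ## Corollaries: `S[X]/(f)` with `f` monic, and the polynomial base -/

section Corollaries

variable {S : Type u} [CommRing S]

/-- `S[X]/(f)` is free of finite rank over `S` for `f` monic (power basis). [folklore] -/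
theorem adjoinRoot_free_finite_of_monic {f : S[X]} (hf : f.Monic) :
    Module.Free S (AdjoinRoot f) ∧ Module.Finite S (AdjoinRoot f) :=
  ⟨Module.Free.of_basis (AdjoinRoot.powerBasis' hf).basis,
    Module.Finite.of_basis (AdjoinRoot.powerBasis' hf).basis⟩

/-- **Jacobian criterion for `B = S[X]/(f)`, `f` monic**, `S` noetherian with `caᵈ⁺¹(S) = S`:
`(f'(z), f^{δᵢ}(z) : i)·B ⊆ caᵈ⁺¹(B)`, `z` the class of `X`. [folklore] -/
theorem adjoinRoot_span_jacobian_le [IsNoetherianRing S] {d : ℕ}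
    (hvan : cohomologyAnnihilatorOfDegree S (d + 1) = ⊤) {R : Type*} [CommRing R] [Algebra R S]
    {ι : Type*} (δ : ι → Derivation R S S) {f : S[X]} (hf : f.Monic) :
    Ideal.span (insert (aeval (AdjoinRoot.root f) (derivative f))
        (Set.range fun i => ∑ k ∈ f.support, δ i (f.coeff k) • AdjoinRoot.root f ^ k)) ≤
      cohomologyAnnihilatorOfDegree (AdjoinRoot f) (d + 1) := by
  obtain ⟨hfree, hfin⟩ := adjoinRoot_free_finite_of_monic hf
  haveI := hfree
  haveI := hfin
  exact span_jacobian_le_cohomologyAnnihilatorOfDegree_aeval hvan δ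
    (AdjoinRoot.adjoinRoot_eq_top (f := f)) f (AdjoinRoot.aeval_eq f ▸ AdjoinRoot.mk_self)

/-- **Jacobian criterion for a hypersurface `f(x₁, …, x_d, z) = 0` monic in `z` over a field** (every
characteristic): in `B = k[x₁, …, x_d][z]/(f)` the ideal `(∂f/∂z, ∂f/∂x₁, …, ∂f/∂x_d)·B` — the
`xᵢ`-partials taken coefficientwise, `∂f/∂xᵢ = Σₖ (∂aₖ/∂xᵢ) zᵏ` — lies in `caᵈ⁺¹(B)`. [folklore] -/
theorem mvPolynomial_span_jacobian_le_aeval (k : Type u) [Field k] (d : ℕ)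
    {f : (MvPolynomial (Fin d) k)[X]} (hf : f.Monic) :
    Ideal.span (insert (aeval (AdjoinRoot.root f) (derivative f))
        (Set.range fun i : Fin d =>
          ∑ j ∈ f.support, MvPolynomial.pderiv i (f.coeff j) • AdjoinRoot.root f ^ j)) ≤
      cohomologyAnnihilatorOfDegree (AdjoinRoot f) (d + 1) :=
  adjoinRoot_span_jacobian_le (cohomologyAnnihilatorOfDegree_mvPolynomial_eq_top k d)
    (fun i => MvPolynomial.pderiv i) hf

end Corollaries

end Summit.ResolutionOfSingularities.ResolutionOfSingularities.Theorems.HomologicalConductor.PersistenceMonogenicJacobianCorollaries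

end
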